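import Mathlib
import Literature.Analysis.PDE.InverseSquareChannelIdentity
import HarnessLib

/-!
# Exterior channel energy of exact inverse-square waves: the `t → −∞` end

Analysis/PDE support file (everything proved). Time-reversal twin of
`Literature.Analysis.PDE.inverseSquare_channel_limit_atTop` (`InverseSquareChannelIdentity.lean`):
under the same hypotheses (profiles `F, G ∈ C^{n+2}` constant on `[B,∞)` with `F + G = 0` there,
`1 ≤ R ≤ B`), the exterior energy of `ψ(t,·) = ladder ι n (F(·−t) + G(·+t))` on `{x > R + |t|}`
converges as `t → −∞` to the INCOMING profile energy `2∫_R^B (G^{(n+1)})²`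
(`inverseSquare_channel_limit_atBot`). Proof: apply the `atTop` statement to the reversed wave
`(t,x) ↦ Φ(−t,x)`, whose profiles are `(G, F)`. Route PhotonSphereChannels, `FixedModeChannels`,
far side (stmt-FinalStateConjecture-10048).
-/

noncomputable section

namespace Literature.Analysis.PDE

open Set Filter Topology MeasureTheory Literature.Analysis.ODE

variable {ι : ℝ → ℝ}

/-- **Exterior channel energy of exact inverse-square waves, `t → −∞`.**
[cite: KenigEtAl2015, Theorem 5 (exterior energy, odd d)] -/
theorem inverseSquare_channel_limit_atBot (hι : ContDiff ℝ (⊤ : ℕ∞) ι)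
    (hιeq : ∀ x : ℝ, 1 / 2 ≤ x → ι x = x⁻¹) (n : ℕ) {F G : ℝ → ℝ}
    (hF : ContDiff ℝ ((n + 2 : ℕ) : ℕ∞) F) (hG : ContDiff ℝ ((n + 2 : ℕ) : ℕ∞) G) {R B : ℝ}
    (hR : 1 ≤ R) (hRB : R ≤ B) (hFB : ∀ x, B ≤ x → F x = F B) (hGB : ∀ x, B ≤ x → G x = -F B)
    {Φ : ℝ → ℝ → ℝ} (hΦ : ∀ t x, Φ t x = F (x - t) + G (x + t)) :
    Tendsto (fun t => ∫ x in Ioi (R - t),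
        (deriv (fun τ => ladder ι n (Φ τ) x) t ^ 2 + deriv (ladder ι n (Φ t)) x ^ 2
          + (n : ℝ) * (n + 1) * ι x ^ 2 * ladder ι n (Φ t) x ^ 2)) atBot
      (𝓝 (2 * ∫ y in R..B, iteratedDeriv (n + 1) G y ^ 2)) := by
  -- the reversed wave has profiles `(G, F)`
  have hGB' : ∀ x, B ≤ x → G x = G B := fun x hx => by rw [hGB x hx, hGB B le_rfl]
  have hFB' : ∀ x, B ≤ x → F x = -G B := fun x hx => by
    rw [hFB x hx, hGB B le_rfl]; ring
  have hΦr : ∀ t x, (fun t x => Φ (-t) x) t x = G (x - t) + F (x + t) := by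
    intro t x
    show Φ (-t) x = G (x - t) + F (x + t)
    rw [hΦ]; ring_nf
  have h := inverseSquare_channel_limit_atTop hι hιeq n hG hF hR hRB hGB' hFB' hΦr
  -- identify the reversed integrand with the original one at time `-t`
  have hint : ∀ t x, deriv (fun τ => ladder ι n ((fun t x => Φ (-t) x) τ) x) t ^ 2
        + deriv (ladder ι n ((fun t x => Φ (-t) x) t)) x ^ 2
        + (n : ℝ) * (n + 1) * ι x ^ 2 * ladder ι n ((fun t x => Φ (-t) x) t) x ^ 2
      = deriv (fun τ => ladder ι n (Φ τ) x) (-t) ^ 2 + deriv (ladder ι n (Φ (-t))) x ^ 2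
        + (n : ℝ) * (n + 1) * ι x ^ 2 * ladder ι n (Φ (-t)) x ^ 2 := by
    intro t x
    have e : (fun τ => ladder ι n ((fun t x => Φ (-t) x) τ) x)
        = fun τ => (fun σ => ladder ι n (Φ σ) x) (-τ) := rfl
    rw [e, deriv_comp_neg (fun σ => ladder ι n (Φ σ) x) t, even_two.neg_pow]
  simp only [hint] at h
  -- `t ↦ -t`
  have h2 := h.comp tendsto_neg_atBot_atTop
  refine (h2.congr fun t => ?_)
  simp only [Function.comp, neg_neg, sub_eq_add_neg]

end Literature.Analysis.PDE
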